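import Summits.NavierStokesRegularity.NavierStokesRegularity.Theorems.FilamentSkeletonRssCoreLinearInvertibilityClassClosureToolsA
import Literature.Analysis.FluidPDE.GaussianVortexPlanarProofs
import Literature.Analysis.FluidPDE.BiotSavart2DSymmetry
import Literature.Analysis.FluidPDE.WholeSpaceIBP
import Summits.AnomalousDissipation.AnomalousDissipation.Theorems.MarginalStabilityChainStretchedVortexRowsStubBiotSavartYoung
import Summits.AnomalousDissipation.AnomalousDissipation.Theorems.MarginalStabilityChainStretchedVortexRowsStubCellSolvabilityTools

/-!
# Tools for stub `stub_classClosure` (crux `CoreLinearInvertibility`, stmt-NavierStokesRegularity-17973,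
# route `FilamentSkeletonRss`, line `Sketch`) — part B: Gaussian weights and the nonlocal term

Gaussian weight algebra for `G_λ = gaussWeightLam λ = (1−λ)/(4π) e^{−(1−λ)|x|²/4}` and
`G = gaussVortexProfile = G₀`:

* `G_μ ≤ (1−μ)/(1−ν) G_ν` (`μ ≤ ν < 1`), `|x|² G_μ ≤ 16/(1−μ) G_{(1+μ)/2}` (so `|x|²G_μ ∈ L¹`),
  `G²/G_λ = G_{−λ}/(1−λ²)`;
* `|x_i| w ∈ L¹` for `w ∈ X_λ = L²(G_λ⁻¹dx)` and `X_λ ⊆ L¹ ∩ L²` (tree `MemL2InftyLam.integrable`);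
* **the nonlocal term `⟪K∗v, ∇G⟫` in `X_λ`**: with the Young weight `h = G_λ^{-1/2}‖∇G‖`
  (`h² = ¼|x|²G²/G_λ`, bounded, `h² ∈ L¹`) and the tree's Young-type bound
  `∫ ‖K∗v‖² h² ≤ C(H²∫v² + ‖v‖₁²∫h²)` (`biotSavart2D_mul_sq_integral_le`),
  `∫ G_λ⁻¹ ⟪K∗v, ∇G⟫² ≤ C (∫ v² + ‖v‖₁²)` for every continuous `v ∈ L¹ ∩ L²`.

References: Th. Gallay, C. E. Wayne, J. Math. Fluid Mech. 9 (2007), (1.3) (the kernel `K`);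
Th. Gallay, Y. Maekawa, arXiv:1610.08384, §4.1 (4.5)–(4.6); folklore estimates.
-/

set_option linter.dupNamespace false

noncomputable section

namespace Summit.NavierStokesRegularity.NavierStokesRegularity.Theorems

open Set Function Filter MeasureTheory Topology
open Literature.Analysis.FluidPDE
open Summit.AnomalousDissipation.AnomalousDissipation.Theorems.MarginalStabilityChainStretchedVortexRows
open scoped InnerProductSpace

/-! ### Gaussian weight algebra -/

section Gauss

/-- Comparison of the weights: `G_μ ≤ (1−μ)/(1−ν) G_ν` for `μ ≤ ν < 1`. [folklore] -/
theorem gaussWeightLam_le_mul {μ ν : ℝ} (hμν : μ ≤ ν) (hν : ν < 1) (x : EuclideanSpace ℝ (Fin 2)) :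
    gaussWeightLam μ x ≤ (1 - μ) / (1 - ν) * gaussWeightLam ν x := by
  unfold gaussWeightLam
  have h1 : 0 < 1 - ν := by linarith
  have h2 : 0 ≤ 1 - μ := by linarith
  have hexp : Real.exp (-((1 - μ) / 4 * ‖x‖ ^ 2)) ≤ Real.exp (-((1 - ν) / 4 * ‖x‖ ^ 2)) :=
    Real.exp_le_exp.2 (by nlinarith [sq_nonneg ‖x‖])
  calc (1 - μ) / (4 * Real.pi) * Real.exp (-((1 - μ) / 4 * ‖x‖ ^ 2))
      ≤ (1 - μ) / (4 * Real.pi) * Real.exp (-((1 - ν) / 4 * ‖x‖ ^ 2)) :=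
        mul_le_mul_of_nonneg_left hexp (by positivity)
    _ = (1 - μ) / (1 - ν) * ((1 - ν) / (4 * Real.pi) * Real.exp (-((1 - ν) / 4 * ‖x‖ ^ 2))) := by
        field_simp

/-- Second Gaussian moment, pointwise: `|x|² G_μ(x) ≤ 16/(1−μ) G_{(1+μ)/2}(x)` (`t e^{−t} ≤ 1`).
[folklore] -/
theorem norm_sq_mul_gaussWeightLam_le {μ : ℝ} (hμ : μ < 1) (x : EuclideanSpace ℝ (Fin 2)) :
    ‖x‖ ^ 2 * gaussWeightLam μ x ≤ 16 / (1 - μ) * gaussWeightLam ((1 + μ) / 2) x := by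
  unfold gaussWeightLam
  have h1 : 0 < 1 - μ := by linarith
  set e : ℝ := Real.exp (-((1 - μ) / 8 * ‖x‖ ^ 2)) with he
  have he0 : 0 < e := Real.exp_pos _
  -- `t e^{−(1−μ)t/8} ≤ 8/(1−μ)`
  have hkey : ‖x‖ ^ 2 * e ≤ 8 / (1 - μ) := by
    have hs : (1 - μ) / 8 * ‖x‖ ^ 2 ≤ Real.exp ((1 - μ) / 8 * ‖x‖ ^ 2) := by
      linarith [Real.add_one_le_exp ((1 - μ) / 8 * ‖x‖ ^ 2)]
    have hE : Real.exp ((1 - μ) / 8 * ‖x‖ ^ 2) * e = 1 := by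
      rw [he, ← Real.exp_add, add_neg_cancel, Real.exp_zero]
    have h3 : (1 - μ) / 8 * ‖x‖ ^ 2 * e ≤ 1 := by
      calc (1 - μ) / 8 * ‖x‖ ^ 2 * e ≤ Real.exp ((1 - μ) / 8 * ‖x‖ ^ 2) * e :=
            mul_le_mul_of_nonneg_right hs he0.le
        _ = 1 := hE
    rw [le_div_iff₀ h1]
    nlinarith
  have hsplit : Real.exp (-((1 - μ) / 4 * ‖x‖ ^ 2)) = e * e := by
    rw [he, ← Real.exp_add]
    congr 1
    ring
  have hr1 : (1 - (1 + μ) / 2) / (4 * Real.pi) = (1 - μ) / (8 * Real.pi) := by ring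
  have hr2 : -((1 - (1 + μ) / 2) / 4 * ‖x‖ ^ 2) = -((1 - μ) / 8 * ‖x‖ ^ 2) := by ring
  rw [hr1, hr2, ← he, hsplit]
  have hpi : 0 < Real.pi := Real.pi_pos
  calc ‖x‖ ^ 2 * ((1 - μ) / (4 * Real.pi) * (e * e))
      = (1 - μ) / (4 * Real.pi) * e * (‖x‖ ^ 2 * e) := by ring
    _ ≤ (1 - μ) / (4 * Real.pi) * e * (8 / (1 - μ)) :=
        mul_le_mul_of_nonneg_left hkey (by positivity)
    _ = 16 / (1 - μ) * ((1 - μ) / (8 * Real.pi) * e) := by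
        field_simp
        ring

/-- `|x|² G_μ` is integrable for `μ < 1`. [folklore] -/
theorem integrable_norm_sq_mul_gaussWeightLam {μ : ℝ} (hμ : μ < 1) :
    Integrable (fun x : EuclideanSpace ℝ (Fin 2) => ‖x‖ ^ 2 * gaussWeightLam μ x) := by
  have hμ' : (1 + μ) / 2 < 1 := by linarith
  refine Integrable.mono' ((integrable_gaussWeightLam hμ').const_mul (16 / (1 - μ)))
    ((continuous_norm.pow 2).mul (continuous_gaussWeightLam μ)).aestronglyMeasurable
    (Eventually.of_forall fun x => ?_)
  rw [Real.norm_of_nonneg (mul_nonneg (sq_nonneg _) (gaussWeightLam_pos hμ x).le)]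
  exact norm_sq_mul_gaussWeightLam_le hμ x

/-- `G²/G_λ = G_{−λ}/(1 − λ²)` (`G = gaussVortexProfile = G₀`), for `0 ≤ λ < 1`. [folklore] -/
theorem inv_gaussWeightLam_mul_sq_gaussVortexProfile {lam : ℝ} (h0 : 0 ≤ lam) (h1 : lam < 1)
    (x : EuclideanSpace ℝ (Fin 2)) :
    (gaussWeightLam lam x)⁻¹ * gaussVortexProfile x ^ 2 = (1 - lam ^ 2)⁻¹ * gaussWeightLam (-lam) x := by
  have hA : gaussWeightLam lam x ≠ 0 := (gaussWeightLam_pos h1 x).ne'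
  rw [inv_mul_eq_iff_eq_mul₀ hA]
  unfold gaussWeightLam gaussVortexProfile
  have hl : (1 - lam) ≠ 0 := by linarith
  have hl' : (1 + lam) ≠ 0 := by linarith
  have hl2 : 1 - lam ^ 2 = (1 - lam) * (1 + lam) := by ring
  have hexp : Real.exp (-(‖x‖ ^ 2 / 4)) ^ 2 =
      Real.exp (-((1 - lam) / 4 * ‖x‖ ^ 2)) * Real.exp (-((1 - -lam) / 4 * ‖x‖ ^ 2)) := by
    rw [sq, ← Real.exp_add, ← Real.exp_add]
    congr 1
    ring
  rw [mul_pow, hexp, hl2]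
  field_simp
  ring

/-- **`|x_i| w ∈ L¹` for `w ∈ X_λ`**: `|x_i w| ≤ ½ (|x|² G_λ + w²/G_λ)`. [folklore] -/
theorem integrable_coord_mul_of_memX {lam : ℝ} (hlam : lam < 1) {w : EuclideanSpace ℝ (Fin 2) → ℝ}
    (hwm : AEStronglyMeasurable w volume)
    (hwX : Integrable (fun x => (gaussWeightLam lam x)⁻¹ * w x ^ 2)) (i : Fin 2) :
    Integrable (fun x : EuclideanSpace ℝ (Fin 2) => x i * w x) := by
  refine Integrable.mono' (((integrable_norm_sq_mul_gaussWeightLam hlam).add hwX).div_const 2)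
    ((PiLp.continuous_apply 2 _ i).aestronglyMeasurable.mul hwm) (Eventually.of_forall fun x => ?_)
  have hG := gaussWeightLam_pos hlam x
  have hxi : |x i| ≤ ‖x‖ := FourierNS.abs_apply_le_norm x i
  rw [Real.norm_eq_abs, abs_mul]
  change |x i| * |w x| ≤ (‖x‖ ^ 2 * gaussWeightLam lam x + (gaussWeightLam lam x)⁻¹ * w x ^ 2) / 2
  rw [le_div_iff₀ (by norm_num : (0 : ℝ) < 2)]
  have h1 : |x i| * |w x| ≤ ‖x‖ * |w x| := mul_le_mul_of_nonneg_right hxi (abs_nonneg _)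
  -- AM–GM: `2‖x‖|w| ≤ ‖x‖² G + w²/G`
  have h2 : ‖x‖ * |w x| * 2 ≤ ‖x‖ ^ 2 * gaussWeightLam lam x + (gaussWeightLam lam x)⁻¹ * w x ^ 2 := by
    have key : ‖x‖ ^ 2 * gaussWeightLam lam x + (gaussWeightLam lam x)⁻¹ * w x ^ 2 - ‖x‖ * |w x| * 2 =
        (gaussWeightLam lam x)⁻¹ * (‖x‖ * gaussWeightLam lam x - |w x|) ^ 2 := by
      rw [sub_sq, ← sq_abs (w x)] ; field_simp; ring
    have h0 : 0 ≤ (gaussWeightLam lam x)⁻¹ * (‖x‖ * gaussWeightLam lam x - |w x|) ^ 2 := by positivity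
    linarith
  linarith

/-- **`X_λ ⊆ L¹ ∩ L²`** in the form used here (tree: `MemL2InftyLam.integrable`,
`MemL2InftyLam.integrable_sq`). [folklore] -/
theorem integrable_and_sq_of_memX {lam : ℝ} (hlam : lam < 1) {w : EuclideanSpace ℝ (Fin 2) → ℝ}
    (hwm : AEStronglyMeasurable w volume)
    (hwX : Integrable (fun x => (gaussWeightLam lam x)⁻¹ * w x ^ 2)) :
    Integrable w ∧ Integrable (fun x => w x ^ 2) := by
  have hmem : MemL2InftyLam lam w := ⟨hwm, by simpa [div_eq_inv_mul] using hwX⟩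
  exact ⟨hmem.integrable hlam, hmem.integrable_sq hlam⟩

end Gauss

/-! ### The nonlocal term in `X_λ` -/

section Young

variable {lam : ℝ}

/-- `G_λ⁻¹ ⟪V, ∇G⟫² ≤ ‖V‖² h²` for the Young weight `h = G_λ^{-1/2} ‖∇G‖`. [folklore] -/
theorem inv_gaussWeightLam_mul_inner_gradient_sq_le (hlam : lam < 1) (V x : EuclideanSpace ℝ (Fin 2)) :
    (gaussWeightLam lam x)⁻¹ * ⟪V, gradient gaussVortexProfile x⟫_ℝ ^ 2 ≤
      ‖V‖ ^ 2 * (Real.sqrt ((gaussWeightLam lam x)⁻¹) * ‖gradient gaussVortexProfile x‖) ^ 2 := by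
  rw [mul_pow, Real.sq_sqrt (inv_nonneg.2 (gaussWeightLam_pos hlam x).le)]
  have h := abs_real_inner_le_norm V (gradient gaussVortexProfile x)
  have h2 : ⟪V, gradient gaussVortexProfile x⟫_ℝ ^ 2 ≤ (‖V‖ * ‖gradient gaussVortexProfile x‖) ^ 2 := by
    rw [← sq_abs]
    exact pow_le_pow_left₀ (abs_nonneg _) h 2
  have hg : 0 ≤ (gaussWeightLam lam x)⁻¹ := inv_nonneg.2 (gaussWeightLam_pos hlam x).le
  calc (gaussWeightLam lam x)⁻¹ * ⟪V, gradient gaussVortexProfile x⟫_ℝ ^ 2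
      ≤ (gaussWeightLam lam x)⁻¹ * (‖V‖ * ‖gradient gaussVortexProfile x‖) ^ 2 :=
        mul_le_mul_of_nonneg_left h2 hg
    _ = ‖V‖ ^ 2 * ((gaussWeightLam lam x)⁻¹ * ‖gradient gaussVortexProfile x‖ ^ 2) := by ring

/-- **The Young weight is Gaussian-dominated**: `h² = ¼|x|² G²/G_λ ≤ 4/((1−λ²)(1+λ)) G_{(1−λ)/2}`.
[folklore] -/
theorem youngWeight_sq_le (hlam : lam ∈ Set.Ico (0 : ℝ) 1) (x : EuclideanSpace ℝ (Fin 2)) :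
    (Real.sqrt ((gaussWeightLam lam x)⁻¹) * ‖gradient gaussVortexProfile x‖) ^ 2 ≤
      4 / ((1 - lam ^ 2) * (1 + lam)) * gaussWeightLam ((1 - lam) / 2) x := by
  have h0 := hlam.1
  have h1 := hlam.2
  have hl2 : 0 < 1 - lam ^ 2 := by nlinarith
  rw [mul_pow, Real.sq_sqrt (inv_nonneg.2 (gaussWeightLam_pos h1 x).le), gradient_gaussVortexProfile,
    norm_smul, norm_neg, Real.norm_eq_abs,
    abs_of_nonneg (by linarith [gaussVortexProfile_pos x] : 0 ≤ gaussVortexProfile x / 2)]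
  have hm := norm_sq_mul_gaussWeightLam_le (μ := -lam) (by linarith) x
  have hr : (1 + -lam) / 2 = (1 - lam) / 2 := by ring
  rw [hr, show (1 : ℝ) - -lam = 1 + lam by ring] at hm
  calc (gaussWeightLam lam x)⁻¹ * (gaussVortexProfile x / 2 * ‖x‖) ^ 2
      = 4⁻¹ * ‖x‖ ^ 2 * ((gaussWeightLam lam x)⁻¹ * gaussVortexProfile x ^ 2) := by ring
    _ = 4⁻¹ * (1 - lam ^ 2)⁻¹ * (‖x‖ ^ 2 * gaussWeightLam (-lam) x) := by
        rw [inv_gaussWeightLam_mul_sq_gaussVortexProfile h0 h1]; ring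
    _ ≤ 4⁻¹ * (1 - lam ^ 2)⁻¹ * (16 / (1 + lam) * gaussWeightLam ((1 - lam) / 2) x) :=
        mul_le_mul_of_nonneg_left hm (by positivity)
    _ = 4 / ((1 - lam ^ 2) * (1 + lam)) * gaussWeightLam ((1 - lam) / 2) x := by
        field_simp
        ring

/-- **The nonlocal term in `X_λ`** (Young-type bound, tree `biotSavart2D_mul_sq_integral_le` with
the bounded square-integrable weight `h = G_λ^{-1/2}‖∇G‖`): there is `C ≥ 0` with
`G_λ⁻¹⟪K∗v, ∇G⟫² ∈ L¹` and `∫ G_λ⁻¹ ⟪K∗v, ∇G⟫² ≤ C (∫ v² + (∫|v|)²)` for every continuous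
`v ∈ L¹ ∩ L²`. [folklore] -/
theorem exists_inv_gaussWeightLam_mul_inner_biotSavart2D_sq_le (hlam : lam ∈ Set.Ico (0 : ℝ) 1) :
    ∃ C : ℝ, 0 ≤ C ∧ ∀ v : EuclideanSpace ℝ (Fin 2) → ℝ, Continuous v → Integrable v →
      Integrable (fun x => v x ^ 2) →
      Integrable (fun x => (gaussWeightLam lam x)⁻¹ *
        ⟪biotSavart2D v x, gradient gaussVortexProfile x⟫_ℝ ^ 2) ∧
      ∫ x, (gaussWeightLam lam x)⁻¹ * ⟪biotSavart2D v x, gradient gaussVortexProfile x⟫_ℝ ^ 2 ≤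
        C * ((∫ x, v x ^ 2) + (∫ x, |v x|) ^ 2) := by
  obtain ⟨C, hC, hY⟩ := biotSavart2D_mul_sq_integral_le
  have hμ : (1 - lam) / 2 < 1 := by linarith [hlam.1]
  have hl2 : 0 < 1 - lam ^ 2 := by nlinarith [hlam.1, hlam.2]
  have hl3 : 0 < 1 + lam := by linarith [hlam.1]
  -- the Young weight `h`, its bound `H` and `∫ h²`
  set h : EuclideanSpace ℝ (Fin 2) → ℝ := fun x =>
    Real.sqrt ((gaussWeightLam lam x)⁻¹) * ‖gradient gaussVortexProfile x‖ with hh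
  have hcont : Continuous h :=
    (Real.continuous_sqrt.comp (continuous_inv_gaussWeightLam hlam.2)).mul
      (continuous_gradient_of_contDiff (contDiff_gaussVortexProfile (n := 1))).norm
  set H : ℝ := Real.sqrt (4 / ((1 - lam ^ 2) * (1 + lam)) * ((1 - (1 - lam) / 2) / (4 * Real.pi)))
  have hH : ∀ x, |h x| ≤ H := fun x => by
    rw [← Real.sqrt_sq_eq_abs]
    refine Real.sqrt_le_sqrt ((youngWeight_sq_le hlam x).trans ?_)
    exact mul_le_mul_of_nonneg_left (gaussWeightLam_le hμ x) (by positivity)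
  have hh2 : Integrable (fun x => h x ^ 2) := by
    refine Integrable.mono'
      ((integrable_gaussWeightLam hμ).const_mul (4 / ((1 - lam ^ 2) * (1 + lam))))
      (hcont.pow 2).aestronglyMeasurable (Eventually.of_forall fun x => ?_)
    rw [Real.norm_of_nonneg (sq_nonneg _)]
    exact youngWeight_sq_le hlam x
  set I : ℝ := ∫ x, h x ^ 2
  have hI : 0 ≤ I := integral_nonneg fun x => sq_nonneg _
  refine ⟨C * (H ^ 2 + I), by positivity, fun v hv hvi hv2 => ?_⟩
  obtain ⟨hint, hle⟩ := hY v h H hv hvi hv2 hcont.aestronglyMeasurable hH hh2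
  have hpt : ∀ x, (gaussWeightLam lam x)⁻¹ * ⟪biotSavart2D v x, gradient gaussVortexProfile x⟫_ℝ ^ 2 ≤
      ‖biotSavart2D v x‖ ^ 2 * h x ^ 2 := fun x =>
    inv_gaussWeightLam_mul_inner_gradient_sq_le hlam.2 _ x
  have hmeas : AEStronglyMeasurable (fun x => (gaussWeightLam lam x)⁻¹ *
      ⟪biotSavart2D v x, gradient gaussVortexProfile x⟫_ℝ ^ 2) volume :=
    (continuous_inv_gaussWeightLam hlam.2).aestronglyMeasurable.mul
      (((stronglyMeasurable_biotSavart2D hv.measurable).aestronglyMeasurable.inner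
        (continuous_gradient_of_contDiff
          (contDiff_gaussVortexProfile (n := 1))).aestronglyMeasurable).pow 2)
  have hnn : ∀ x, 0 ≤ (gaussWeightLam lam x)⁻¹ * ⟪biotSavart2D v x, gradient gaussVortexProfile x⟫_ℝ ^ 2 :=
    fun x => mul_nonneg (inv_nonneg.2 (gaussWeightLam_pos hlam.2 x).le) (sq_nonneg _)
  have hInt : Integrable (fun x => (gaussWeightLam lam x)⁻¹ *
      ⟪biotSavart2D v x, gradient gaussVortexProfile x⟫_ℝ ^ 2) :=
    hint.mono' hmeas (Eventually.of_forall fun x => by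
      rw [Real.norm_of_nonneg (hnn x)]
      exact hpt x)
  refine ⟨hInt, (integral_mono hInt hint hpt).trans (hle.trans ?_)⟩
  have ha : 0 ≤ ∫ x, v x ^ 2 := integral_nonneg fun x => sq_nonneg _
  have hb : 0 ≤ (∫ x, |v x|) ^ 2 := sq_nonneg _
  have hH2 : 0 ≤ H ^ 2 := sq_nonneg _
  nlinarith [mul_nonneg (mul_nonneg hC.le hH2) hb, mul_nonneg (mul_nonneg hC.le hI) ha]

end Young

/-- **Registered tools stub `stub_classClosureToolsB`** (helpers for `stub_classClosure`, line
`Sketch` of crux `CoreLinearInvertibility`, stmt-NavierStokesRegularity-17973): Gaussian moment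
bounds, `|x_i| w ∈ L¹` on `X_λ`, and the Young-type bound for the nonlocal term. [folklore] -/
theorem stub_classClosureToolsB :
    (∀ (μ : ℝ) (x : EuclideanSpace ℝ (Fin 2)), μ < 1 →
      ‖x‖ ^ 2 * gaussWeightLam μ x ≤ 16 / (1 - μ) * gaussWeightLam ((1 + μ) / 2) x) ∧
    (∀ (lam : ℝ) (w : EuclideanSpace ℝ (Fin 2) → ℝ) (i : Fin 2), lam < 1 →
      AEStronglyMeasurable w volume → Integrable (fun x => (gaussWeightLam lam x)⁻¹ * w x ^ 2) →
      Integrable (fun x : EuclideanSpace ℝ (Fin 2) => x i * w x)) ∧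
    (∀ lam ∈ Set.Ico (0 : ℝ) 1, ∃ C : ℝ, 0 ≤ C ∧ ∀ v : EuclideanSpace ℝ (Fin 2) → ℝ, Continuous v →
      Integrable v → Integrable (fun x => v x ^ 2) →
      Integrable (fun x => (gaussWeightLam lam x)⁻¹ *
        ⟪biotSavart2D v x, gradient gaussVortexProfile x⟫_ℝ ^ 2) ∧
      ∫ x, (gaussWeightLam lam x)⁻¹ * ⟪biotSavart2D v x, gradient gaussVortexProfile x⟫_ℝ ^ 2 ≤
        C * ((∫ x, v x ^ 2) + (∫ x, |v x|) ^ 2)) :=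
  ⟨fun _ x hμ => norm_sq_mul_gaussWeightLam_le hμ x,
    fun _ _ i hlam hwm hwX => integrable_coord_mul_of_memX hlam hwm hwX i,
    fun _ hlam => exists_inv_gaussWeightLam_mul_inner_biotSavart2D_sq_le hlam⟩

end Summit.NavierStokesRegularity.NavierStokesRegularity.Theorems
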